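import Summits.CriticalPhenomena.PercolationContinuityZ3.Theses.PercFiniteBoxLRO
import Summits.CriticalPhenomena.PercolationContinuityZ3.Theses.PercOpenSupercrit
import Summits.CriticalPhenomena.PercolationContinuityZ3.Theorems.PercFiniteBoxLRORenormaliseFromLinearLRODefs
import Summits.CriticalPhenomena.PercolationContinuityZ3.Theorems.PercFiniteBoxLRORenormaliseFromLinearLROStubCoarseDependent
import Summits.CriticalPhenomena.PercolationContinuityZ3.Theorems.PercFiniteBoxLRORenormaliseFromLinearLROStubCoarseDensity
import Summits.CriticalPhenomena.PercolationContinuityZ3.Theorems.PercFiniteBoxLRORenormaliseFromLinearLROStubCoarseGlue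
import Literature.Probability.Percolation.SlabCriticalityInputs
import Literature.Probability.Percolation.ConnectivityProofs

/-!
# Crux `PercFiniteBoxLRO.RenormaliseFromLinearLRO` (stmt-CriticalPhenomena-0857), line `registered` —
# the SAME-`p` good-box criterion (registered stub `stub_sameP_criterion`), proved

`stub_sameP_criterion`: there is `δ > 0` such that for every `p ∈ [0,1]` and every `n ≥ 1`,
`P_p(G_n) > 1 − δ ⇒ θ_{ℤ³}(p) > 0`, where `G_n` is Grimmett's good-box event of `B(n) = [-n,n]³`
(open crossing cluster + in-box uniqueness of the clusters of coordinate spread `≥ n`; Grimmett,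
*Percolation* (1999), §7.4 p.177 (a)+(b)).  This is the finite-size criterion of the static
renormalisation READ AT FIXED `p` — no sprinkling anywhere (Grimmett §7.4 pp.178–181; Duminil-Copin–Kozma–
Tassion 2020 §1.1 Example 1 "⇐"): the planar layer of blocks `a ∈ ℤ² ↦ blockCentre n a + B(n)` is run
through the PROVED dependent-percolation theorem
`Literature.Probability.Percolation.DuminilCopinSidoraviciusTassion2016_dependentPercolation_holds`
(Liggett–Schonmann–Stacey / Grimmett Thm (7.65) for `ℤ²`, proved in the tree by a Peierls argument), fed by
the three landed stubs of the line: `stub_coarseDependent` (the coarse law is `3`-dependent, p148843),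
`stub_coarseDensity` (coarse edges are open with probability `≥ 2 P_p(G_n) − 1`, p149525) and
`stub_coarseGlue` (an infinite coarse cluster of good blocks carries an infinite open cluster meeting
`B(n)`, p150840); then a union bound over `B(n)` and `θ_x = θ_0`.

The statement is VERBATIM the sibling route's crux `PercOpenSupercrit.GoodBoxCriterionSameP`
(item stmt-CriticalPhenomena-3840); the corollary `goodBoxCriterionSameP_proof` records this (its type is
literally that route decl), so that item can be closed by it.

Lands `--supports stmt-CriticalPhenomena-0857` (registered stub `stub_sameP_criterion`).
-/

noncomputable section

namespace Summit.CriticalPhenomena.PercolationContinuityZ3.Theorems.RenormaliseFromLinearLRO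

open Literature.Probability.Percolation Literature.Probability.LatticeModels
open MeasureTheory

/-- **The same-`p` good-box criterion over the named event `goodBox`**: `∃ δ > 0, ∀ p, ∀ n ≥ 1,
P_p(goodBox n) > 1 − δ → θ(p) > 0`.  Proof: `δ := η(3)/2` with `η` from the DST dependent-percolation
theorem; for `P_p(G_n) > 1 − δ` the coarse law `coarseLaw n p` is a `3`-dependent bond percolation on `ℤ²`
(`stub_coarseDependent`) with lattice-edge densities `≥ 2 P_p(G_n) − 1 > 1 − η` (`stub_coarseDensity`),
hence percolates from `0`; pulled back through `coarseCfg n` and glued on the full-measure set of lattice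
configurations (`stub_coarseGlue`) this gives `P_p(⋃_{x ∈ B(n)} {x ↔ ∞}) > 0`, whence `θ_0(p) > 0` by the
union bound over the finite box and translation invariance `θ_x = θ_0`. -/
theorem sameP_criterion_goodBox :
    ∃ δ : ℝ, 0 < δ ∧ ∀ (p : unitInterval) (n : ℕ), 1 ≤ n →
      1 - δ < (bondPercolation (zdGraph 3) p).real (goodBox n) → 0 < theta (zdGraph 3) 0 p := by
  obtain ⟨η, hη, hD⟩ := DuminilCopinSidoraviciusTassion2016_dependentPercolation_holds 3
  refine ⟨η / 2, half_pos hη, ?_⟩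
  intro p n hn hgood
  -- (1) the coarse law is a 3-dependent bond percolation on ℤ² with edge densities ≥ 1 - η: it percolates
  have hdens : ∀ e ∈ (zdGraph 2).edgeSet, 1 - η ≤ (coarseLaw n p).real {σ | e ∈ σ} := by
    intro e he
    have h := stub_coarseDensity p n hn e he
    linarith
  have hperc : 0 < (coarseLaw n p).real (percolatesAt (0 : Site 2)) :=
    hD (coarseLaw n p) (stub_coarseDependent p n hn) hdens
  -- (2) pull back to ℤ³ and glue on lattice configurations (a full-measure set)
  simp only [coarseLaw] at hperc
  rw [map_measureReal_apply (measurable_coarseCfg n) (measurableSet_percolatesAt_holds (0 : Site 2))]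
    at hperc
  have hle : (bondPercolation (zdGraph 3) p).real (coarseCfg n ⁻¹' percolatesAt (0 : Site 2)) ≤
      (bondPercolation (zdGraph 3) p).real (⋃ x ∈ box 3 n, percolatesAt x) := by
    refine ENNReal.toReal_mono (measure_ne_top _ _) (measure_mono_ae ?_)
    filter_upwards [ProbabilityTheory.setBernoulli_ae_subset (u := (zdGraph 3).edgeSet) (p := p)]
      with ω hω hmem
    obtain ⟨x, hx, hinf⟩ := stub_coarseGlue n hn ω hω hmem
    exact Set.mem_iUnion₂.2 ⟨x, hx, hinf⟩
  have hpos : 0 < (bondPercolation (zdGraph 3) p).real (⋃ x ∈ box 3 n, percolatesAt x) :=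
    hperc.trans_le hle
  -- (3) union bound over the finite box and translation invariance θ_x = θ_0
  have hub : (bondPercolation (zdGraph 3) p).real (⋃ x ∈ box 3 n, percolatesAt x) ≤
      ∑ x ∈ box 3 n, (bondPercolation (zdGraph 3) p).real (percolatesAt x) :=
    measureReal_biUnion_finset_le _ _
  have hsum : ∑ x ∈ box 3 n, (bondPercolation (zdGraph 3) p).real (percolatesAt x) =
      ((box 3 n).card : ℝ) * theta (zdGraph 3) 0 p := by
    have hx : ∀ x ∈ box 3 n,
        (bondPercolation (zdGraph 3) p).real (percolatesAt x) = theta (zdGraph 3) 0 p :=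
      fun x _ => theta_zdGraph_eq_theta_zero p x
    rw [Finset.sum_congr rfl hx, Finset.sum_const, nsmul_eq_mul]
  by_contra hθ
  have hθ0 : theta (zdGraph 3) 0 p = 0 := le_antisymm (not_lt.1 hθ) measureReal_nonneg
  rw [hθ0, mul_zero] at hsum
  linarith

/-- **Registered stub `stub_sameP_criterion` of crux stmt-CriticalPhenomena-0857 (line `registered`): the
same-`p` good-box criterion with the event spelled out** — there is `δ > 0` such that for every `p ∈ [0,1]`
and every `n ≥ 1`, `P_p(G_n) > 1 − δ ⇒ θ_{ℤ³}(p) > 0` (Grimmett 1999 §7.4 read at fixed `p`; no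
sprinkling).  Definitionally `sameP_criterion_goodBox`. -/
theorem stub_sameP_criterion :
    ∃ δ : ℝ, 0 < δ ∧ ∀ (p : unitInterval) (n : ℕ), 1 ≤ n →
      1 - δ < (bondPercolation (zdGraph 3) p).real {ω : BondConfig (Site 3) |
        (∃ x : Site 3, ∀ i : Fin 3,
            (∃ u : Site 3, u i = -(n : ℤ) ∧ ω ∈ openConnIn ↑(box 3 n) x u) ∧
              (∃ v : Site 3, v i = (n : ℤ) ∧ ω ∈ openConnIn ↑(box 3 n) x v)) ∧
          (∀ x y : Site 3,
            (∃ u v : Site 3, ω ∈ openConnIn ↑(box 3 n) x u ∧ ω ∈ openConnIn ↑(box 3 n) x v ∧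
                ∃ i, (n : ℤ) ≤ |u i - v i|) →
              (∃ u v : Site 3, ω ∈ openConnIn ↑(box 3 n) y u ∧ ω ∈ openConnIn ↑(box 3 n) y v ∧
                  ∃ i, (n : ℤ) ≤ |u i - v i|) →
                ω ∈ openConnIn ↑(box 3 n) x y)} →
        0 < theta (zdGraph 3) 0 p :=
  sameP_criterion_goodBox

/-- **Item stmt-CriticalPhenomena-3840 (`PercOpenSupercrit.GoodBoxCriterionSameP`), proved**: the sibling
route's same-`p` good-box criterion is VERBATIM `stub_sameP_criterion` (definitional unfolding only). -/
theorem goodBoxCriterionSameP_proof :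
    Summit.CriticalPhenomena.PercolationContinuityZ3.Theses.PercOpenSupercrit.GoodBoxCriterionSameP :=
  stub_sameP_criterion

end Summit.CriticalPhenomena.PercolationContinuityZ3.Theorems.RenormaliseFromLinearLRO

end
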